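import Summits.QuantumFields.YangMills.Theorems.UnitScaleTiltProp7TwistedLinkFrameSup
import Summits.QuantumFields.YangMills.Theorems.UnitScaleTiltProp7TwistedLevelMassInduction
import Summits.QuantumFields.YangMills.Theorems.UnitScaleTiltProp7HolRatioWalkSum
import Summits.QuantumFields.YangMills.Theorems.UnitScaleTiltProp7FibreLevelMassPerLevelT3
import Summits.QuantumFields.YangMills.Theorems.UnitScaleTiltProp7SymFrameUnitary
import Summits.QuantumFields.YangMills.Theorems.UnitScaleTiltProp7CovCombMeanFrames
import Summits.QuantumFields.YangMills.Theorems.UnitScaleTiltProp7FrameCorrectedMinusMeanT3Rows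
import Summits.QuantumFields.YangMills.Theorems.UnitScaleTiltProp8ChartBridgeAllL
import Literature.MathematicalPhysics.QuantumFieldTheory.Balaban1983to89.B12B0LoopGeometry267
import HarnessLib

/-!
# Route `UnitScaleTilt`, crux K1 «MinimiserStabilityRegPr» (stmt-QuantumFields-19200), route-R E′ (A′) «HCOW-VIA-Σ», row P-A2 «JOINT-Σ», file F3″-C2 —
# THE TWISTED TOWER AT T³ (d = 3, `SU(2)`): THE `SU(2) ↔ (M₂)ˣ` DICTIONARY ON THE GUARDS, THE STAIR ROW FROM (n3)'s TWO-BLOCK SUP, AND THE JOINT LEVEL INDUCTION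
# «ACCUMULATED FRAMES ∈ SU(2) ∧ ‖v_l − 1‖_∞ ≤ 2ρ_l», `ρ_l = θLˡ∕(7800L³L^{K−n})` — NO frame window displayed

Cell `ym3-torus`, width seat `ym3-torus-px17` (gen 3); px22 g3 ■ FINAL «F3″-C is the one pen left»; LOCATE `LOCATE-PA2-F3C-T3KNIT-px17g3.md` (19200 evidence #50).  THE POINT.  The covariant
double-bar tower `V^{(l)} = dbarCovIterU l U₀♭ W♭` (`♭ = unitsField ∘ toUField`) of the competitor against the background tower `Ū₀^{(l)} = emlIterU l U₀♭` is, by (97), the plain tower in the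
accumulated frames `v_l = frameAccU l U₀♭ W♭`.  F3″-B2c (✓ `Prop7FrameMassStep.frameMass_step_le`) and F3″-C1 (✓ `Prop7TwistedLinkFrameSup`) display per level: U1 rows of frames and transports,
the frame sup `‖v_l − 1‖ ≤ δ₂`, and the single-bar stair ratios `‖R_i(y) − 1‖ ≤ C_R√B(y) ≤ ρ`.  Here all of them are INHABITED at T³ from (n3)'s two-block sup rows `μ_j` (✓ `Prop7FibreLevelMassPerLevelT3`'s
binders) and the (0.4) guards of both towers: §1 the dictionary (✓ `Prop8Chart.coe_emlIterU_unitsField`: on the guards the unguarded tower IS the `SU(2)` tower, so transports and links are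
special unitary and the single-bar ratio is (n3)'s `pertVar`), §2 the stair row with `C_R = 3L` (✓ `Prop7HolRatioWalkSum` + lit `stair_src_tgt_blockOf`; `3L√B(y) ≤ μ`), §3 the JOINT induction over
levels — the frames stay special unitary (`eml` of SU(2) data within `1∕3` of `1`, ✓ `su2_pred_closure`) and within `2ρ_l` of `1` in sup, because the sup step (✓ `norm_frameAccU_succ_sub_one_le_sup`)
has the GEOMETRIC source `μ_l ≤ ρ_l`, `ρ_{l+1} = Lρ_l` ((n3)'s `hμθ`), so `δ_l ≤ 2ρ_l` survives (✓ `supStep_le`).  The `Φ`-recursion and the title are the sibling file F3″-C3 (✓ `Prop7TwistedLevelMassT3`).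
THEOREMS ONLY (0 `def`, 0 `sorry`); `--supports stmt-QuantumFields-19200`, count-neutral.  YM₃ on T³ is a ladder rung (R3), not the Clay problem; nothing here claims the stub, the crux, d = 4 or the gap.

References: T. Bałaban, CMP 98 (1985) 17–51 [Balaban1985Averaging] ((9), (19) pp.19–21, (56)–(58) p.27, (82) p.30, (89) p.31, (97) p.32, Prop. 3 (122)–(126) p.36); CMP 109 (1987) 249–301 [Balaban1987RG1]
((0.3)–(0.4), (0.9)–(0.11) pp.252–253); CMP 102 (1985) 277–309 [Balaban1985Variational] ((15) p.280); CMP 102 (1985) 255–275 [Balaban1985UV3] ((1)–(3) p.256).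
-/

set_option autoImplicit false

noncomputable section

open scoped BigOperators Matrix.Norms.L2Operator

namespace Summit.QuantumFields.YangMills.Theorems.Prop7TwistedTowerFramesT3

open Finset
open Literature.MathematicalPhysics.QuantumFieldTheory.Balaban1983to89
open Literature.MathematicalPhysics.QuantumFieldTheory.Balaban1983to89.T3ContinuumYM3Torus
open T4Continuum T4ReflectionCone BlockAveraging AveragingRT ExpMeanLog BlockAveragingEMLLinearisedBackground
open B10Eq27TorusAxialLog (holT transl unitsField toUField)
open B7Prop1Explicit (disp)
open T3RegularMinimiser (regThreshold)
open B9Eq39Adjoint (curl divB)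
open B9TorusCalculus (torusT)
open Summit.QuantumFields.YangMills.Theorems.Prop8Chart (emlIterU coe_emlIterU_unitsField coe_unitsField_toUField)
open Summit.QuantumFields.YangMills.Theorems.Prop8ChartAllL (small_iter_T3_allL)
open Summit.QuantumFields.YangMills.Theorems.Prop7SymAvgTwSym (tstairU vframeCovU coe_vframeCovU frameAccU frameAccU_zero frameAccU_succ dbarCovIterU)
open Summit.QuantumFields.YangMills.Theorems.Prop7AccumulatedFrameStep (tstairU_eq_frame_inv_mul)
open Summit.QuantumFields.YangMills.Theorems.Prop7FrameMassStep (norm_conj_sub_one_le norm_conj_le_one frameMass_step_le)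
open Summit.QuantumFields.YangMills.Theorems.Prop7TwistedLinkFrameSup (sum_normSq_twistedLink_le norm_tstairU_sub_one_le_sup norm_frameAccU_succ_sub_one_le_sup supStep_le)
open Summit.QuantumFields.YangMills.Theorems.Prop7TwistedLevelMassInduction (twistedMass_le_LOnly)
open Summit.QuantumFields.YangMills.Theorems.Prop7HolRatioWalkSum (norm_holRatio_sub_one_le_walkSum)
open Summit.QuantumFields.YangMills.Theorems.Prop7CovCombMeanFrames (coe_holT_su coe_inv_holT_su)
open Summit.QuantumFields.YangMills.Theorems.Prop7SymFrameBound (su2_pred_closure)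
open Summit.QuantumFields.YangMills.Theorems.Prop7FrameCorrectedMinusMean (norm_le_one_of_mem_specialUnitaryGroup)

/-! ## §1 The dictionary `SU(2) ↔ (M₂)ˣ` on the (0.4) guards -/

section Dictionary

variable {P : Params}

/-- **THE TOWERS AGREE AS FIELDS ON THE GUARDS**: if the (0.4) loop variables of every `Ū^{(i)}`, `i < k`, are `δ_{SU(2)}`-small, then `emlIterU i (U♭) = (Ū^{(i)})♭` for every `i ≤ k`
(✓ `Prop8Chart.coe_emlIterU_unitsField`, fieldwise). [cite: Balaban1987RG1, (0.4) and (0.11) p.253] -/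
theorem emlIterU_eq_unitsField_iter (U : GaugeField P 0 (Matrix.specialUnitaryGroup (Fin 2) ℂ)) (k : ℕ)
    (hsmall : ∀ i, i < k → ∀ c : PBond P (i + 1), Small (expMeanLogSU (n := Fin 2)) (Averaging.iter (fun j => blockAvg (P := P) (j := j) (expMeanLogSU (n := Fin 2))) i U) c)
    {i : ℕ} (hi : i ≤ k) :
    emlIterU i (unitsField (toUField U)) = unitsField (toUField (Averaging.iter (fun j => blockAvg (P := P) (j := j) (expMeanLogSU (n := Fin 2))) i U)) := by
  funext b
  apply Units.ext
  rw [coe_emlIterU_unitsField U k hsmall i hi b, coe_unitsField_toUField]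

/-- a special unitary `2 × 2` matrix has operator norm `1`. [folklore] -/
theorem norm_eq_one_of_mem_su2 {M : Matrix (Fin 2) (Fin 2) ℂ} (hM : M ∈ Matrix.specialUnitaryGroup (Fin 2) ℂ) : ‖M‖ = 1 :=
  UnitaryModel.norm_of_mem_unitaryGroup (Matrix.specialUnitaryGroup_le_unitaryGroup hM)

/-- the bond variables of an `SU(2)` field read in `(M₂)ˣ` are special unitary. [cite: Balaban1985Averaging, (19) p.21] -/
theorem coe_unitsField_mem_su2 {j : ℕ} (V : GaugeField P j (Matrix.specialUnitaryGroup (Fin 2) ℂ)) (b : PBond P j) :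
    ((unitsField (toUField V) b : (Matrix (Fin 2) (Fin 2) ℂ)ˣ) : Matrix (Fin 2) (Fin 2) ℂ) ∈ Matrix.specialUnitaryGroup (Fin 2) ℂ := by
  rw [coe_unitsField_toUField]; exact (V b).2

/-- the transports of an `SU(2)` field read in `(M₂)ˣ` are special unitary (✓ `coe_holT_su`). [cite: Balaban1985Averaging, (9) p.19] -/
theorem coe_holT_unitsField_mem_su2 {j : ℕ} (V : GaugeField P j (Matrix.specialUnitaryGroup (Fin 2) ℂ)) (x : Site P j) (w : List (Letter P.d)) :
    ((holT (unitsField (toUField V)) x w : (Matrix (Fin 2) (Fin 2) ℂ)ˣ) : Matrix (Fin 2) (Fin 2) ℂ) ∈ Matrix.specialUnitaryGroup (Fin 2) ℂ := by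
  rw [coe_holT_su]; exact (holAt V (walk x w)).2

/-- **THE SINGLE-BAR RATIO IS (n3)'s `pertVar`**: `(W♭ b)·(U₀♭ b)⁻¹ − 1 = pertVar U₀ W b` as matrices. [cite: Balaban1985Variational, (15) p.280] -/
theorem coe_unitsField_mul_inv_sub_one {j : ℕ} (U₀ W : GaugeField P j (Matrix.specialUnitaryGroup (Fin 2) ℂ)) (b : PBond P j) :
    ((unitsField (toUField W) b * (unitsField (toUField U₀) b)⁻¹ : (Matrix (Fin 2) (Fin 2) ℂ)ˣ) : Matrix (Fin 2) (Fin 2) ℂ) - 1 = pertVar U₀ W b := by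
  rw [pertVar, Units.val_mul, coe_unitsField_toUField, Submonoid.coe_mul]
  rfl

/-- **THE SINGLE-BAR STAIR RATIO IS THE RELATIVE HOLONOMY**: `W♭(Γ)·(U₀♭(Γ))⁻¹ = W(Γ)·U₀(Γ)*` as matrices (✓ `coe_holT_su`, ✓ `coe_inv_holT_su`). [cite: Balaban1985Averaging, (58) p.27] -/
theorem coe_holT_mul_inv_eq {j : ℕ} (U₀ W : GaugeField P j (Matrix.specialUnitaryGroup (Fin 2) ℂ)) (x : Site P j) (w : List (Letter P.d)) :
    ((holT (unitsField (toUField W)) x w * (holT (unitsField (toUField U₀)) x w)⁻¹ : (Matrix (Fin 2) (Fin 2) ℂ)ˣ) : Matrix (Fin 2) (Fin 2) ℂ)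
      = ((holAt W (walk x w) : Matrix.specialUnitaryGroup (Fin 2) ℂ) : Matrix (Fin 2) (Fin 2) ℂ) * star ((holAt U₀ (walk x w) : Matrix.specialUnitaryGroup (Fin 2) ℂ) : Matrix (Fin 2) (Fin 2) ℂ) := by
  rw [Units.val_mul, coe_holT_su, coe_inv_holT_su]

end Dictionary

/-! ## §2 The stair row of ✓ `frameMass_step_le` from a two-block sup -/

section Stair

variable {P : Params} {k : ℕ}

/-- `(1 + x)ⁿ ≤ 2` when `0 ≤ x` and `n·x ≤ ½` (`1 + x ≤ eˣ`, `e^{1∕2} ≤ 1 + ½ + ¼`). [folklore] -/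
theorem one_add_pow_le_two {x : ℝ} (hx : 0 ≤ x) (n : ℕ) (hn : (n : ℝ) * x ≤ 1 / 2) : (1 + x) ^ n ≤ 2 := by
  have h1 : (1 + x) ^ n ≤ Real.exp ((n : ℝ) * x) := by
    rw [Real.exp_nat_mul]
    exact pow_le_pow_left₀ (by positivity) (by linarith [Real.add_one_le_exp x]) n
  have h2 : Real.exp ((n : ℝ) * x) ≤ Real.exp (1 / 2) := Real.exp_le_exp.2 hn
  have h3 : Real.exp (1 / 2 : ℝ) ≤ 2 := by
    have h := Real.abs_exp_sub_one_sub_id_le (x := (1 / 2 : ℝ)) (by rw [abs_of_pos (by norm_num)]; norm_num)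
    have := (abs_le.1 h).2
    nlinarith
  exact h1.trans (h2.trans h3)

/-- the `ℓ¹` mass of a walk whose bonds all start in `B(y)` is at most `|Γ|·√B(y)`, `B(y)` the `ℓ²` block mass. [folklore] -/
theorem walkSum_le_length_mul_sqrt (Y : PBond P k → Matrix (Fin 2) (Fin 2) ℂ) (y : Site P (k + 1)) :
    ∀ γ : List (LStep P k), (∀ s ∈ γ, blockOf s.bond.src = y) →
      (γ.map fun s => ‖Y s.bond‖).sum ≤ (γ.length : ℝ) * Real.sqrt (∑ b ∈ univ.filter (fun b : PBond P k => blockOf b.src = y), ‖Y b‖ ^ 2)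
  | [], _ => by simp
  | s :: γ, h => by
    rw [List.map_cons, List.sum_cons, List.length_cons]
    push_cast
    have hs : ‖Y s.bond‖ ≤ Real.sqrt (∑ b ∈ univ.filter (fun b : PBond P k => blockOf b.src = y), ‖Y b‖ ^ 2) := by
      rw [← Real.sqrt_sq (norm_nonneg (Y s.bond))]
      exact Real.sqrt_le_sqrt (Finset.single_le_sum (f := fun b => ‖Y b‖ ^ 2) (fun b _ => sq_nonneg _)
        (Finset.mem_filter.2 ⟨Finset.mem_univ _, h s (List.mem_cons_self)⟩))
    have ih := walkSum_le_length_mul_sqrt Y y γ fun s' hs' => h s' (List.mem_cons_of_mem _ hs')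
    linarith

/-- the staircase words of (0.3) have at most `3L∕2` letters at `d = 3` (`|off r ν| ≤ ⌊(L−1)∕2⌋`, lit ✓ `length_stairWord_le`). [cite: Balaban1987RG1, (0.3) p.252] -/
theorem length_walk_stairWord_le (hd : P.d = 3) (y : Site P (k + 1)) (i : Idx P) :
    ((walk (emb y) (stairWord i.2.1 (off i.1))).length : ℝ) ≤ 3 * (P.L : ℝ) / 2 := by
  rw [T4AvgDerivBound.length_walk]
  have h := LatticeWordStokes.length_stairWord_le i.2.1 (off i.1) ((P.L - 1) / 2) fun ν => by have := off_bounds i.1 ν; omega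
  have h' : ((stairWord i.2.1 (off i.1)).length : ℝ) ≤ (P.d : ℝ) * (((P.L - 1) / 2 : ℕ) : ℝ) := by exact_mod_cast h
  have hd' : (P.d : ℝ) = 3 := by exact_mod_cast hd
  rw [hd'] at h'
  refine h'.trans ?_
  have hdiv : (((P.L - 1) / 2 : ℕ) : ℝ) ≤ ((P.L - 1 : ℕ) : ℝ) / 2 := Nat.cast_div_le
  have hsub : ((P.L - 1 : ℕ) : ℝ) ≤ (P.L : ℝ) := by exact_mod_cast Nat.sub_le P.L 1
  linarith

/-- ★★ **THE STAIR ROW AND ITS SUP FROM A TWO-BLOCK SUP** (d = 3, `SU(2)`, level `k`, `k + 1 ≤ m + K`): for `SU(2)` fields `V₀, V` with `Y := pertVar V₀ V`, a two-block walk-mass sup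
`5L·Σ_{b : B(b₋) ∈ {c₋, c₊}} ‖Y b‖ ≤ μ ≤ 1∕72` at every coarse bond `c`, and `B(y) := Σ_{b : B(b₋) = y} ‖Y b‖²`:
`‖V(Γ_i(y))·V₀(Γ_i(y))* − 1‖ ≤ 3L·√B(y)` for every centre staircase, and `3L·√B(y) ≤ μ` (✓ `norm_holRatio_sub_one_le_walkSum`, staircase bonds inside `B(y)`, `(1 + μ∕(5L))^{3L∕2} ≤ 2`).
[cite: Balaban1985Averaging, (56)-(58) p.27, Prop. 3 (122)-(123) p.36; Balaban1987RG1, (0.3) p.252] -/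
theorem stair_row_of_twoBlockSup (hd : P.d = 3) (hk : k + 1 ≤ P.m + P.K) (V₀ V : GaugeField P k (Matrix.specialUnitaryGroup (Fin 2) ℂ)) {μ : ℝ}
    (hμ : ∀ c : PBond P (k + 1), (((P.d + 2) * P.L : ℕ) : ℝ) * ∑ b ∈ univ.filter (fun b : PBond P k => blockOf b.src = c.src ∨ blockOf b.src = c.tgt), ‖pertVar V₀ V b‖ ≤ μ)
    (hμ72 : 72 * μ ≤ 1) :
    (∀ (y : Site P (k + 1)) (i : Idx P),
        ‖((holAt V (walk (emb y) (stairWord i.2.1 (off i.1))) : Matrix.specialUnitaryGroup (Fin 2) ℂ) : Matrix (Fin 2) (Fin 2) ℂ)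
            * star ((holAt V₀ (walk (emb y) (stairWord i.2.1 (off i.1))) : Matrix.specialUnitaryGroup (Fin 2) ℂ) : Matrix (Fin 2) (Fin 2) ℂ) - 1‖
          ≤ 3 * (P.L : ℝ) * Real.sqrt (∑ b ∈ univ.filter (fun b : PBond P k => blockOf b.src = y), ‖pertVar V₀ V b‖ ^ 2)) ∧
      (∀ y : Site P (k + 1), 3 * (P.L : ℝ) * Real.sqrt (∑ b ∈ univ.filter (fun b : PBond P k => blockOf b.src = y), ‖pertVar V₀ V b‖ ^ 2) ≤ μ) := by
  have hL1 : (1 : ℝ) ≤ P.L := by exact_mod_cast P.L_pos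
  have hL0 : (0 : ℝ) < P.L := by linarith
  have h5L : (((P.d + 2) * P.L : ℕ) : ℝ) = 5 * (P.L : ℝ) := by rw [hd]; push_cast; ring
  have hd0 : 0 < P.d := by rw [hd]; norm_num
  -- the block `ℓ¹` mass from the two-block sup at `c = ⟨y, 0⟩`
  have hblock : ∀ y : Site P (k + 1), ∑ b ∈ univ.filter (fun b : PBond P k => blockOf b.src = y), ‖pertVar V₀ V b‖ ≤ μ / (5 * (P.L : ℝ)) := by
    intro y
    have h := hμ ⟨y, ⟨0, hd0⟩⟩
    rw [h5L] at h
    rw [le_div_iff₀ (by positivity), mul_comm]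
    refine le_trans (mul_le_mul_of_nonneg_left (Finset.sum_le_sum_of_subset_of_nonneg ?_ fun b _ _ => norm_nonneg _) (by positivity)) h
    intro b hb
    simp only [Finset.mem_filter, Finset.mem_univ, true_and] at hb ⊢
    exact Or.inl hb
  have hL5 : (5 * (P.L : ℝ)) ≠ 0 := by positivity
  have hq0 : ∀ y : Site P (k + 1), 0 ≤ μ / (5 * (P.L : ℝ)) := fun y =>
    (Finset.sum_nonneg fun _ _ => norm_nonneg _).trans (hblock y)
  have hμ0 : ∀ _y : Site P (k + 1), 0 ≤ μ := fun y => by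
    have h := mul_nonneg (hq0 y) (by positivity : (0 : ℝ) ≤ 5 * (P.L : ℝ))
    rwa [div_mul_cancel₀ μ hL5] at h
  -- the global sup `δ₁ = μ∕(5L)`
  have hδ₁ : ∀ b : PBond P k, ‖pertVar V₀ V b‖ ≤ μ / (5 * (P.L : ℝ)) := by
    intro b
    have hmem : b ∈ univ.filter (fun b' : PBond P k => blockOf b'.src = blockOf b.src) := by
      rw [Finset.mem_filter]; exact ⟨Finset.mem_univ b, rfl⟩
    have h1 : ‖pertVar V₀ V b‖ ≤ ∑ b' ∈ univ.filter (fun b' : PBond P k => blockOf b'.src = blockOf b.src), ‖pertVar V₀ V b'‖ :=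
      Finset.single_le_sum (f := fun b' => ‖pertVar V₀ V b'‖) (fun b' _ => norm_nonneg (pertVar V₀ V b')) hmem
    exact h1.trans (hblock (blockOf b.src))
  -- `√B(y) ≤ Σ_{B(y)} ‖Y‖ ≤ μ∕(5L)`
  have hsqrt : ∀ y : Site P (k + 1), Real.sqrt (∑ b ∈ univ.filter (fun b : PBond P k => blockOf b.src = y), ‖pertVar V₀ V b‖ ^ 2) ≤ μ / (5 * (P.L : ℝ)) := by
    intro y
    refine (Real.sqrt_le_sqrt (Finset.sum_sq_le_sq_sum_of_nonneg fun b _ => norm_nonneg (pertVar V₀ V b))).trans ?_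
    rw [Real.sqrt_sq (Finset.sum_nonneg fun _ _ => norm_nonneg _)]
    exact hblock y
  refine ⟨fun y i => ?_, fun y => ?_⟩
  · have hq0y := hq0 y
    have hμ0y := hμ0 y
    have hB2b := norm_holRatio_sub_one_le_walkSum V₀ V hq0y hδ₁ (walk (emb y) (stairWord i.2.1 (off i.1)))
    have hlen := length_walk_stairWord_le hd y i
    have hws := walkSum_le_length_mul_sqrt (pertVar V₀ V) y (walk (emb y) (stairWord i.2.1 (off i.1)))
      fun s hs => (B12B0LoopGeometry267.stair_src_tgt_blockOf hk y i.2.1 i.1 s hs).1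
    have hpow : (1 + μ / (5 * (P.L : ℝ))) ^ (walk (emb y) (stairWord i.2.1 (off i.1))).length ≤ 2 := by
      refine one_add_pow_le_two hq0y _ ?_
      calc ((walk (emb y) (stairWord i.2.1 (off i.1))).length : ℝ) * (μ / (5 * (P.L : ℝ))) ≤ (3 * (P.L : ℝ) / 2) * (μ / (5 * (P.L : ℝ))) :=
            mul_le_mul_of_nonneg_right hlen hq0y
        _ = 3 * μ / 10 := by field_simp; ring
        _ ≤ 1 / 2 := by linarith
    have hS0 : 0 ≤ Real.sqrt (∑ b ∈ univ.filter (fun b : PBond P k => blockOf b.src = y), ‖pertVar V₀ V b‖ ^ 2) := Real.sqrt_nonneg _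
    have hsum0 : 0 ≤ ((walk (emb y) (stairWord i.2.1 (off i.1))).map fun s => ‖pertVar V₀ V s.bond‖).sum :=
      List.sum_nonneg fun x hx => by obtain ⟨s', _, rfl⟩ := List.mem_map.1 hx; exact norm_nonneg _
    calc _ ≤ (1 + μ / (5 * (P.L : ℝ))) ^ (walk (emb y) (stairWord i.2.1 (off i.1))).length * ((walk (emb y) (stairWord i.2.1 (off i.1))).map fun s => ‖pertVar V₀ V s.bond‖).sum := hB2b
      _ ≤ 2 * (((walk (emb y) (stairWord i.2.1 (off i.1))).length : ℝ) * Real.sqrt (∑ b ∈ univ.filter (fun b : PBond P k => blockOf b.src = y), ‖pertVar V₀ V b‖ ^ 2)) :=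
          mul_le_mul hpow hws hsum0 (by norm_num)
      _ ≤ 2 * ((3 * (P.L : ℝ) / 2) * Real.sqrt (∑ b ∈ univ.filter (fun b : PBond P k => blockOf b.src = y), ‖pertVar V₀ V b‖ ^ 2)) := by gcongr
      _ = 3 * (P.L : ℝ) * Real.sqrt (∑ b ∈ univ.filter (fun b : PBond P k => blockOf b.src = y), ‖pertVar V₀ V b‖ ^ 2) := by ring
  · have hμ0y := hμ0 y
    calc 3 * (P.L : ℝ) * Real.sqrt (∑ b ∈ univ.filter (fun b : PBond P k => blockOf b.src = y), ‖pertVar V₀ V b‖ ^ 2) ≤ 3 * (P.L : ℝ) * (μ / (5 * (P.L : ℝ))) :=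
          mul_le_mul_of_nonneg_left (hsqrt y) (by positivity)
      _ = 3 * μ / 5 := by field_simp
      _ ≤ μ := by linarith

end Stair

/-! ## §3 The geometric majorant `ρ_l = θLˡ∕(7800L³L^{K−n})` of (n3)'s two-block sups and the JOINT level induction «frames ∈ SU(2) ∧ sup ≤ 2ρ_l» -/

section Rho

/-- the source majorant is non-negative, grows by the factor `L ≥ 2` per level, and is tiny below the top (`10³θL ≤ 1`): `0 ≤ ρ_l`, `2ρ_l ≤ ρ_{l+1}`, `ρ_l ≤ 10⁻⁶`, `ρ_l·L ≤ 10⁻⁶`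
for `l < k`. [folklore] -/
theorem rho_facts {L θ : ℝ} (hL3 : 3 ≤ L) (hθ0 : 0 ≤ θ) (hθL : 1000 * θ * L ≤ 1) (k l : ℕ) (hl : l < k) :
    0 ≤ θ * L ^ l / (7800 * L ^ 3 * L ^ k) ∧
      2 * (θ * L ^ l / (7800 * L ^ 3 * L ^ k)) ≤ θ * L ^ (l + 1) / (7800 * L ^ 3 * L ^ k) ∧
      θ * L ^ l / (7800 * L ^ 3 * L ^ k) ≤ 1 / 10 ^ 6 ∧
      θ * L ^ l / (7800 * L ^ 3 * L ^ k) * L ≤ 1 / 10 ^ 6 := by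
  have hL0 : 0 < L := by linarith
  have hL1 : 1 ≤ L := by linarith
  have hden : 0 < 7800 * L ^ 3 * L ^ k := by positivity
  have h0 : 0 ≤ θ * L ^ l / (7800 * L ^ 3 * L ^ k) := by positivity
  refine ⟨h0, ?_, ?_, ?_⟩
  · rw [mul_div_assoc', div_le_div_iff_of_pos_right hden, pow_succ]
    have hx : 0 ≤ θ * L ^ l := mul_nonneg hθ0 (pow_nonneg hL0.le l)
    nlinarith [mul_le_mul_of_nonneg_left (show (2 : ℝ) ≤ L by linarith) hx]
  · -- `ρ_l ≤ ρ_l·L ≤ θ∕7800 ≤ 10⁻⁶`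
    have hLl : θ * L ^ l ≤ θ * L ^ k := mul_le_mul_of_nonneg_left (pow_le_pow_right₀ hL1 hl.le) hθ0
    rw [div_le_iff₀ hden]
    have hθ : θ ≤ 1 / 1000 := by nlinarith
    have hL3k : (27 : ℝ) ≤ L ^ 3 := by
      have := pow_le_pow_left₀ (by norm_num : (0 : ℝ) ≤ 3) hL3 3; norm_num at this; exact this
    nlinarith [pow_nonneg hL0.le k, mul_nonneg hθ0 (pow_nonneg hL0.le k)]
  · have hLl : θ * L ^ (l + 1) ≤ θ * L ^ k := mul_le_mul_of_nonneg_left (pow_le_pow_right₀ hL1 (Nat.succ_le_of_lt hl)) hθ0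
    rw [div_mul_eq_mul_div, mul_assoc, ← pow_succ, div_le_iff₀ hden]
    have hθ : θ ≤ 1 / 1000 := by nlinarith
    have hL3k : (27 : ℝ) ≤ L ^ 3 := by
      have := pow_le_pow_left₀ (by norm_num : (0 : ℝ) ≤ 3) hL3 3; norm_num at this; exact this
    nlinarith [pow_nonneg hL0.le k, mul_nonneg hθ0 (pow_nonneg hL0.le k)]

/-- (n3)'s `hμθ` says the two-block sup is below the majorant: `7800L³L^{k}μ_l ≤ θLˡ` ⟹ `μ_l ≤ ρ_l`. [folklore] -/
theorem mu_le_rho {L θ μ : ℝ} (hL0 : 0 < L) (k l : ℕ) (h : 7800 * L ^ 3 * L ^ k * μ ≤ θ * L ^ l) :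
    μ ≤ θ * L ^ l / (7800 * L ^ 3 * L ^ k) := by
  rw [le_div_iff₀ (by positivity)]
  linarith

end Rho

section T3

variable (F : T3Family) (n K : ℕ)

/-- ★★★ **THE JOINT LEVEL INDUCTION: THE ACCUMULATED FRAMES ARE SPECIAL UNITARY AND WITHIN `2ρ_l` OF `1` IN SUP AT EVERY LEVEL `l ≤ K − n`** (d = 3, `SU(2)`), from the
(0.4) guards of both towers and (n3)'s two-block sup rows `hμ hμ72 hμθ hθL` ONLY — no frame window displayed.  Step: U1 rows from SU(2) (level `l`), stair ratios `≤ 3L√B ≤ μ_l ≤ ρ_l`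
(§2), sup step (✓ `norm_frameAccU_succ_sub_one_le_sup`) + `ρ_l + 2ρ_l + 6(7ρ_l)² ≤ 2ρ_{l+1}` (✓ `supStep_le`); special unitarity of `v_{l+1} = v_l(emb y)·eml_i(tstair_i)` from
`‖tstair_i − 1‖ ≤ 7ρ_l ≤ ¼` (✓ `norm_tstairU_sub_one_le_sup`, ✓ `su2_pred_closure`). [cite: Balaban1985Averaging, (82) p.30, (97) p.32, Prop. 3 (122)-(126) p.36; Balaban1987RG1, (0.9)-(0.11) p.253] -/
theorem frameAccU_su2_and_sup (U₀ W : GaugeField (F.P K) 0 (Matrix.specialUnitaryGroup (Fin 2) ℂ))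
    (hU₀g : ∀ i, i < K - n → ∀ c : PBond (F.P K) (i + 1), Small (expMeanLogSU (n := Fin 2)) (Averaging.iter (fun j => blockAvg (P := F.P K) (j := j) (expMeanLogSU (n := Fin 2))) i U₀) c)
    (hWg : ∀ i, i < K - n → ∀ c : PBond (F.P K) (i + 1), Small (expMeanLogSU (n := Fin 2)) (Averaging.iter (fun j => blockAvg (P := F.P K) (j := j) (expMeanLogSU (n := Fin 2))) i W) c)
    (μ : ℕ → ℝ)
    (hμ : ∀ j < K - n, ∀ c : PBond (F.P K) (j + 1), ((((F.P K).d + 2) * (F.P K).L : ℕ) : ℝ) * ∑ b ∈ (univ.filter (fun b : PBond (F.P K) j => blockOf b.src = c.src ∨ blockOf b.src = c.tgt)), ‖(pertVar (Averaging.iter (fun i => blockAvg (P := (F.P K)) (j := i) (expMeanLogSU (n := Fin 2))) j U₀) (Averaging.iter (fun i => blockAvg (P := (F.P K)) (j := i) (expMeanLogSU (n := Fin 2))) j W)) b‖ ≤ μ j)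
    (hμ72 : ∀ j < K - n, 72 * μ j ≤ 1)
    {θ : ℝ} (hθ0 : 0 ≤ θ) (hμθ : ∀ j < K - n, 7800 * (F.L : ℝ) ^ 3 * (F.L : ℝ) ^ (K - n) * μ j ≤ θ * (F.L : ℝ) ^ j)
    (hθL : 1000 * θ * (F.L : ℝ) ≤ 1) :
    ∀ l, l ≤ K - n →
      (∀ x : Site (F.P K) l, ((frameAccU l (unitsField (toUField U₀)) (unitsField (toUField W)) x : (Matrix (Fin 2) (Fin 2) ℂ)ˣ) : Matrix (Fin 2) (Fin 2) ℂ) ∈ Matrix.specialUnitaryGroup (Fin 2) ℂ) ∧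
      (∀ x : Site (F.P K) l, ‖((frameAccU l (unitsField (toUField U₀)) (unitsField (toUField W)) x : (Matrix (Fin 2) (Fin 2) ℂ)ˣ) : Matrix (Fin 2) (Fin 2) ℂ) - 1‖
          ≤ 2 * (θ * (F.L : ℝ) ^ l / (7800 * (F.L : ℝ) ^ 3 * (F.L : ℝ) ^ (K - n)))) := by
  have hL3 : (3 : ℝ) ≤ F.L := Prop7CurvedLandauKnitT3.three_le_L F
  have hL0 : (0 : ℝ) < F.L := by linarith
  have hd : (F.P K).d = 3 := T3Family.P_d F K
  have hLL : ((F.P K).L : ℝ) = F.L := rfl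
  obtain ⟨h1su, hmul, hinv, heml⟩ := su2_pred_closure (P := F.P K)
  intro l
  induction l with
  | zero =>
    intro _
    refine ⟨fun x => ?_, fun x => ?_⟩
    · rw [frameAccU_zero, Units.val_one]; exact h1su
    · rw [frameAccU_zero, Units.val_one, sub_self, norm_zero]
      positivity
  | succ l ih =>
    intro hl
    have hl' : l < K - n := Nat.lt_of_succ_le hl
    have hlK : l + 1 ≤ (F.P K).m + (F.P K).K := by show l + 1 ≤ F.m + K; have := F.hm; omega
    obtain ⟨hsu, hsup⟩ := ih hl'.le
    obtain ⟨hρ0, hρ2, hρ6, hρL6⟩ := rho_facts hL3 hθ0 hθL (K - n) l hl'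
    -- the towers as `SU(2)` fields at level `l`
    have hUeq := emlIterU_eq_unitsField_iter U₀ (K - n) hU₀g hl'.le
    have hWeq := emlIterU_eq_unitsField_iter W (K - n) hWg hl'.le
    -- U1 rows
    have hv1 : ∀ x : Site (F.P K) l, ‖((frameAccU l (unitsField (toUField U₀)) (unitsField (toUField W)) x : (Matrix (Fin 2) (Fin 2) ℂ)ˣ) : Matrix (Fin 2) (Fin 2) ℂ)‖ ≤ 1 :=
      fun x => (norm_le_one_of_mem_specialUnitaryGroup (hsu x)).1
    have hv1' : ∀ x : Site (F.P K) l, ‖(((frameAccU l (unitsField (toUField U₀)) (unitsField (toUField W)) x)⁻¹ : (Matrix (Fin 2) (Fin 2) ℂ)ˣ) : Matrix (Fin 2) (Fin 2) ℂ)‖ ≤ 1 :=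
      fun x => (norm_le_one_of_mem_specialUnitaryGroup (hsu x)).2
    have hνsu : ∀ (y : Site (F.P K) (l + 1)) (i : Idx (F.P K)),
        ((holT (emlIterU l (unitsField (toUField U₀))) (emb y) (stairWord i.2.1 (off i.1)) : (Matrix (Fin 2) (Fin 2) ℂ)ˣ) : Matrix (Fin 2) (Fin 2) ℂ) ∈ Matrix.specialUnitaryGroup (Fin 2) ℂ := by
      intro y i; rw [hUeq]; exact coe_holT_unitsField_mem_su2 _ _ _
    have hν : ∀ (y : Site (F.P K) (l + 1)) (i : Idx (F.P K)),
        ‖((holT (emlIterU l (unitsField (toUField U₀))) (emb y) (stairWord i.2.1 (off i.1)) : (Matrix (Fin 2) (Fin 2) ℂ)ˣ) : Matrix (Fin 2) (Fin 2) ℂ)‖ ≤ 1 ∧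
        ‖(((holT (emlIterU l (unitsField (toUField U₀))) (emb y) (stairWord i.2.1 (off i.1)))⁻¹ : (Matrix (Fin 2) (Fin 2) ℂ)ˣ) : Matrix (Fin 2) (Fin 2) ℂ)‖ ≤ 1 :=
      fun y i => norm_le_one_of_mem_specialUnitaryGroup (hνsu y i)
    -- the stair row `≤ 3L√B ≤ μ_l ≤ ρ_l`
    obtain ⟨hstair, hstairμ⟩ := stair_row_of_twoBlockSup hd hlK
      (Averaging.iter (fun i => blockAvg (P := (F.P K)) (j := i) (expMeanLogSU (n := Fin 2))) l U₀)
      (Averaging.iter (fun i => blockAvg (P := (F.P K)) (j := i) (expMeanLogSU (n := Fin 2))) l W) (hμ l hl') (hμ72 l hl')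
    have hμρ : μ l ≤ θ * (F.L : ℝ) ^ l / (7800 * (F.L : ℝ) ^ 3 * (F.L : ℝ) ^ (K - n)) := mu_le_rho hL0 (K - n) l (hμθ l hl')
    have hR : ∀ (y : Site (F.P K) (l + 1)) (i : Idx (F.P K)),
        ‖((holT (emlIterU l (unitsField (toUField W))) (emb y) (stairWord i.2.1 (off i.1)) * (holT (emlIterU l (unitsField (toUField U₀))) (emb y) (stairWord i.2.1 (off i.1)))⁻¹ :
            (Matrix (Fin 2) (Fin 2) ℂ)ˣ) : Matrix (Fin 2) (Fin 2) ℂ) - 1‖ ≤ θ * (F.L : ℝ) ^ l / (7800 * (F.L : ℝ) ^ 3 * (F.L : ℝ) ^ (K - n)) := by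
      intro y i
      rw [hUeq, hWeq, coe_holT_mul_inv_eq]
      exact (hstair y i).trans ((hLL ▸ hstairμ y).trans hμρ)
    -- the sup step
    obtain ⟨hstep, hwin⟩ := supStep_le _ _ _ hρ0 (by linarith) (by positivity) le_rfl hρ2
    have hsup' : ∀ y : Site (F.P K) (l + 1), ‖((frameAccU (l + 1) (unitsField (toUField U₀)) (unitsField (toUField W)) y : (Matrix (Fin 2) (Fin 2) ℂ)ˣ) : Matrix (Fin 2) (Fin 2) ℂ) - 1‖
        ≤ 2 * (θ * (F.L : ℝ) ^ (l + 1) / (7800 * (F.L : ℝ) ^ 3 * (F.L : ℝ) ^ (K - n))) :=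
      fun y => (norm_frameAccU_succ_sub_one_le_sup l _ _ hρ0 hwin hv1 hv1' hν hsup hR y).trans hstep
    refine ⟨fun y => ?_, hsup'⟩
    -- special unitarity of `v_{l+1}(y) = v_l(emb y)·eml_i(tstair_i)`
    have htsu : ∀ i : Idx (F.P K), ((tstairU (emlIterU l (unitsField (toUField U₀))) (dbarCovIterU l (unitsField (toUField U₀)) (unitsField (toUField W))) y i :
        (Matrix (Fin 2) (Fin 2) ℂ)ˣ) : Matrix (Fin 2) (Fin 2) ℂ) ∈ Matrix.specialUnitaryGroup (Fin 2) ℂ := by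
      intro i
      rw [tstairU_eq_frame_inv_mul, Units.val_mul, Units.val_mul, Units.val_mul, Units.val_mul, Units.val_mul]
      have hWsu : ((holT (emlIterU l (unitsField (toUField W))) (emb y) (stairWord i.2.1 (off i.1)) : (Matrix (Fin 2) (Fin 2) ℂ)ˣ) : Matrix (Fin 2) (Fin 2) ℂ) ∈ Matrix.specialUnitaryGroup (Fin 2) ℂ := by
        rw [hWeq]; exact coe_holT_unitsField_mem_su2 _ _ _
      exact hmul _ _ (hinv _ (hsu _)) (hmul _ _ (hmul _ _ hWsu (hinv _ (hνsu y i))) (hmul _ _ (hmul _ _ (hνsu y i) (hsu _)) (hinv _ (hνsu y i))))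
    have htsmall : ∀ i : Idx (F.P K), ‖((tstairU (emlIterU l (unitsField (toUField U₀))) (dbarCovIterU l (unitsField (toUField U₀)) (unitsField (toUField W))) y i :
        (Matrix (Fin 2) (Fin 2) ℂ)ˣ) : Matrix (Fin 2) (Fin 2) ℂ) - 1‖ ≤ 1 / 3 :=
      fun i => (norm_tstairU_sub_one_le_sup l _ _ (by linarith) hv1 hv1' hν hsup hR y i).trans (by linarith)
    rw [frameAccU_succ, Units.val_mul, coe_vframeCovU]
    exact hmul _ _ (hsu _) (heml _ htsu htsmall)

end T3

end Summit.QuantumFields.YangMills.Theorems.Prop7TwistedTowerFramesT3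

end
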